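import Summits.Schanuel.Schanuel.Theorems.SoloInformedSquaredDifferenceIntegrality

/-!
# The analytic core of Lemma AE: squared-difference values cannot cluster cheaply

Soloist file (informed mode, seat `solo-Schanuel-informed`, s177), continuing
`SoloInformedSymmetricIntegrality` (degree-bounded fundamental theorem of symmetric polynomials,
`a^m · P(roots) ∈ ℤ`) and `SoloInformedSquaredDifferenceIntegrality` (Lemma AE (i):
`|a|^(2D(D−1)²) · ∏ ‖θ p − θ p'‖ ≥ 1`).  This file adds the trivial UPPER bound for the same
product through the MAHLER MEASURE — which is in Mathlib (`Polynomial.mahlerMeasure`,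
`Polynomial.mahlerMeasure_eq_leadingCoeff_mul_prod_roots`) — and combines the two.

Setting.  `F : ℤ[X]`, `F ≠ 0`, `natDegree F = D`, leading coefficient `a`; `ρ : Fin D → ℂ`
enumerates the complex roots with multiplicity (`univ.val.map ρ = (F.map ℂ).roots`); for a finset
`p ⊆ Fin D`, `θ p = (Σ_{i∈p} ρ i)² − 4 ∏_{i∈p} ρ i`, so that `θ {i, j} = (ρ i − ρ j)²`.  Pairs
`(p, p')` range over ORDERED pairs of `2`-subsets of `Fin D` (there are `C(D,2)²` of them);
`M = mahlerMeasure (F.map ℂ) = |a| · ∏_l max 1 ‖ρ l‖`.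

Main results (namespace `Summit.Schanuel.Schanuel.Theorems`, prefix `soloAE_`):
* `soloAE_one_le_pow_mul_mahlerMeasure_pow` — for `0 ≤ ε` and ANY finset `T` of ordered pairs
  `(p, p')` with `θ p ≠ θ p'` and `‖θ p − θ p'‖ ≤ ε`:
  `1 ≤ ε ^ #T · 2 ^ (5 C(D,2)²) · M ^ (2 D (D−1)²)`;
* `soloAE_card_mul_log_le` — the logarithmic form, for `0 < ε`:
  `#T · log (1/ε) ≤ 2 D (D−1)² · log M + 5 C(D,2)² · log 2`.
Supporting lemmas: `‖x − y‖ ≤ 2 max(1,‖x‖) max(1,‖y‖)`; `max 1 ‖θ p‖ ≤ 4 ∏_{l∈p} max(1,‖ρ l‖)²`;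
`∏_p max 1 ‖θ p‖ ≤ 4^{C(D,2)} (M/|a|)^{2(D−1)}` (each index lies in at most `D − 1` pairs,
`soloSD_card_pairs_containing_le`); the pair-product bookkeeping
`∏_{(p,p')} 2 g p g p' = 2^{C²} (∏ g)^{2C}`; `M = |a| ∏ max 1 ‖ρ l‖`; and the exponent identity
`4 C(D,2) (D−1) = 2 D (D−1)²`, which makes the `log |a|` terms of the lower and the upper bound
CANCEL EXACTLY (the product is extended to all `C(D,2)²` ordered pairs, diagonal included, each
generic factor being `≥ 1`).

Proof.  `1 ≤ |a|^m ∏_J ‖θ p − θ p'‖` (Lemma AE (i), `J` = pairs with distinct values, `m =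
2D(D−1)²`); bound the factors in `T` by `ε` and every factor by `2 max(1,‖θ p‖) max(1,‖θ p'‖)`;
`∏_{(p,p')} (2 g p g p') = 2^{C²} G^{2C}` with `G = ∏_p max 1 ‖θ p‖ ≤ 4^C H^{2(D−1)}`,
`H = ∏ max 1 ‖ρ l‖ = M/|a|`; collect: `|a|^m · 2^{C²} · 4^{2C²} · H^{4C(D−1)} = 2^{5C²} M^m`.

What this is NOT.  No statement about `Literature.Periods.SchanuelConjecture`; this is the
analytic half of one lemma (Lemma AE of the seat's note `paper/AE-note.md` §2) on the toy line of
the node `RoyAdditiveDirichletExponent` [cite: Roy2010, Thm 1.1–1.2]; the seat's verdict on the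
summit (no path) is unchanged.  Everything here is classical and claimed by no one as new: the
Mahler-measure bound for products over roots is the standard Liouville-type estimate of
transcendence proofs [cite: Baker1975, Ch. 8 §3, p. 84].  Mathlib supplies the Mahler measure, its
root formula and positivity; no literature hypothesis is used; axioms are the standard three.
-/

namespace Summit.Schanuel.Schanuel.Theorems

open Finset

section Elementary

/-- `‖x − y‖ ≤ 2 · max(1,‖x‖) · max(1,‖y‖)`. -/
theorem soloAE_norm_sub_le_two_mul_max (x y : ℂ) :
    ‖x - y‖ ≤ 2 * max 1 ‖x‖ * max 1 ‖y‖ := by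
  have hx : ‖x‖ ≤ max 1 ‖x‖ := le_max_right _ _
  have hy : ‖y‖ ≤ max 1 ‖y‖ := le_max_right _ _
  have h1x : 1 ≤ max 1 ‖x‖ := le_max_left _ _
  have h1y : 1 ≤ max 1 ‖y‖ := le_max_left _ _
  have h0x : 0 ≤ max 1 ‖x‖ := zero_le_one.trans h1x
  have h0y : 0 ≤ max 1 ‖y‖ := zero_le_one.trans h1y
  calc ‖x - y‖ ≤ ‖x‖ + ‖y‖ := norm_sub_le x y
    _ ≤ max 1 ‖x‖ * max 1 ‖y‖ + max 1 ‖x‖ * max 1 ‖y‖ :=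
        add_le_add (hx.trans (le_mul_of_one_le_right h0x h1y))
          (hy.trans (le_mul_of_one_le_left h0y h1x))
    _ = 2 * max 1 ‖x‖ * max 1 ‖y‖ := by ring

/-- `1 ≤ 2ab` for `a, b ≥ 1`. -/
theorem soloAE_one_le_two_mul_max (a b : ℝ) (ha : 1 ≤ a) (hb : 1 ≤ b) : 1 ≤ 2 * a * b := by
  have := one_le_mul_of_one_le_of_one_le ha hb
  nlinarith

/-- `max(1, ‖(u − v)²‖) ≤ 4 · max(1,‖u‖)² · max(1,‖v‖)²`. -/
theorem soloAE_max_one_norm_sq_sub_le (u v : ℂ) :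
    max 1 ‖(u - v) ^ 2‖ ≤ 4 * (max 1 ‖u‖) ^ 2 * (max 1 ‖v‖) ^ 2 := by
  have h1u : 1 ≤ max 1 ‖u‖ := le_max_left _ _
  have h1v : 1 ≤ max 1 ‖v‖ := le_max_left _ _
  refine max_le ?_ ?_
  · have := one_le_mul_of_one_le_of_one_le (one_le_pow₀ h1u (n := 2))
      (one_le_pow₀ h1v (n := 2))
    nlinarith
  · rw [norm_pow]
    calc ‖u - v‖ ^ 2 ≤ (2 * max 1 ‖u‖ * max 1 ‖v‖) ^ 2 :=
          pow_le_pow_left₀ (norm_nonneg _) (soloAE_norm_sub_le_two_mul_max u v) 2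
      _ = 4 * (max 1 ‖u‖) ^ 2 * (max 1 ‖v‖) ^ 2 := by ring

/-- Exponent bookkeeping: `4 · C(D,2) · (D − 1) = 2 D (D − 1)²`. -/
theorem soloAE_four_mul_choose_two_mul (D : ℕ) :
    4 * D.choose 2 * (D - 1) = 2 * D * (D - 1) ^ 2 := by
  have h2 : D.choose 2 * 2 = D * (D - 1) := by
    rw [Nat.choose_two_right]; exact Nat.div_two_mul_two_of_even (Nat.even_mul_pred_self D)
  calc 4 * D.choose 2 * (D - 1) = 2 * (D.choose 2 * 2) * (D - 1) := by ring
    _ = 2 * (D * (D - 1)) * (D - 1) := by rw [h2]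
    _ = 2 * D * (D - 1) ^ 2 := by ring

end Elementary

section ThetaBounds

variable {D : ℕ}

/-- For a `2`-subset `p = {i, j}`: `max 1 ‖θ p‖ ≤ 4 ∏_{l ∈ p} (max 1 ‖ρ l‖)²`. -/
theorem soloAE_max_one_norm_theta_le (ρ : Fin D → ℂ) (θ : Finset (Fin D) → ℂ)
    (hθ : ∀ p, θ p = (∑ i ∈ p, ρ i) ^ 2 - 4 * ∏ i ∈ p, ρ i)
    (p : Finset (Fin D)) (hp : p.card = 2) :
    max 1 ‖θ p‖ ≤ 4 * ∏ l ∈ p, (max 1 ‖ρ l‖) ^ 2 := by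
  obtain ⟨i, j, hij, rfl⟩ := Finset.card_eq_two.mp hp
  rw [hθ, soloSD_theta_pair ρ hij, Finset.prod_pair hij, ← mul_assoc]
  exact soloAE_max_one_norm_sq_sub_le (ρ i) (ρ j)

/-- `∏_{p : 2-subsets} max 1 ‖θ p‖ ≤ 4^{C(D,2)} · (∏_l max 1 ‖ρ l‖)^{2(D−1)}`. -/
theorem soloAE_prod_max_one_norm_theta_le (ρ : Fin D → ℂ) (θ : Finset (Fin D) → ℂ)
    (hθ : ∀ p, θ p = (∑ i ∈ p, ρ i) ^ 2 - 4 * ∏ i ∈ p, ρ i) :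
    ∏ p : {p : Finset (Fin D) // p.card = 2}, max 1 ‖θ p.1‖ ≤
      4 ^ D.choose 2 * (∏ l, max 1 ‖ρ l‖) ^ (2 * (D - 1)) := by
  classical
  have h1 : ∀ l, 1 ≤ max 1 ‖ρ l‖ := fun l => le_max_left _ _
  have hswap : ∏ p : {p : Finset (Fin D) // p.card = 2}, ∏ l ∈ p.1, (max 1 ‖ρ l‖) ^ 2 =
      ∏ l : Fin D, ∏ p ∈ (univ : Finset {p : Finset (Fin D) // p.card = 2}).filter
        (fun p => l ∈ p.1), (max 1 ‖ρ l‖) ^ 2 :=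
    Finset.prod_comm' (fun p l => by simp)
  calc ∏ p : {p : Finset (Fin D) // p.card = 2}, max 1 ‖θ p.1‖
      ≤ ∏ p : {p : Finset (Fin D) // p.card = 2}, (4 * ∏ l ∈ p.1, (max 1 ‖ρ l‖) ^ 2) :=
        Finset.prod_le_prod (fun p _ => zero_le_one.trans (le_max_left _ _))
          (fun p _ => soloAE_max_one_norm_theta_le ρ θ hθ p.1 p.2)
    _ = 4 ^ D.choose 2 * ∏ l, ((max 1 ‖ρ l‖) ^ 2) ^
          #((univ : Finset {p : Finset (Fin D) // p.card = 2}).filter fun p => l ∈ p.1) := by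
        rw [Finset.prod_mul_distrib, Finset.prod_const, Finset.card_univ, soloSD_card_pairs,
          hswap]
        exact congrArg _ (Finset.prod_congr rfl fun l _ => Finset.prod_const _)
    _ ≤ 4 ^ D.choose 2 * ∏ l, ((max 1 ‖ρ l‖) ^ 2) ^ (D - 1) :=
        mul_le_mul_of_nonneg_left (Finset.prod_le_prod (fun l _ => by positivity)
          (fun l _ => pow_le_pow_right₀ (one_le_pow₀ (h1 l))
            (soloSD_card_pairs_containing_le l))) (by positivity)
    _ = 4 ^ D.choose 2 * (∏ l, max 1 ‖ρ l‖) ^ (2 * (D - 1)) := by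
        rw [Finset.prod_pow, Finset.prod_pow, ← pow_mul]

/-- The Mahler measure of `F` over `ℂ` in terms of an enumeration of its roots. -/
theorem soloAE_mahlerMeasure_map_eq (F : Polynomial ℤ) (ρ : Fin D → ℂ)
    (hρ : univ.val.map ρ = (F.map (Int.castRingHom ℂ)).roots) :
    (F.map (Int.castRingHom ℂ)).mahlerMeasure = |(F.leadingCoeff : ℝ)| * ∏ l, max 1 ‖ρ l‖ := by
  rw [Polynomial.mahlerMeasure_eq_leadingCoeff_mul_prod_roots,
    Polynomial.leadingCoeff_map_of_injective (Int.castRingHom ℂ).injective_int, ← hρ,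
    Multiset.map_map, Finset.prod_map_val]
  simp [Complex.norm_intCast]

/-- Pair-product bookkeeping: `∏_{(p,p')} 2 g(p) g(p') = 2^{C²} (∏ g)^{2C}`, `C = C(D,2)`. -/
theorem soloAE_prod_pairs_eq (g : {p : Finset (Fin D) // p.card = 2} → ℝ) :
    ∏ q : {p : Finset (Fin D) // p.card = 2} × {p : Finset (Fin D) // p.card = 2},
        (2 * g q.1 * g q.2) = 2 ^ (D.choose 2) ^ 2 * (∏ p, g p) ^ (2 * D.choose 2) := by
  rw [Finset.prod_mul_distrib, Finset.prod_mul_distrib, Finset.prod_const, Finset.card_univ,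
    Fintype.card_prod, soloSD_card_pairs]
  have h1 : ∏ q : {p : Finset (Fin D) // p.card = 2} × {p : Finset (Fin D) // p.card = 2},
      g q.1 = (∏ p, g p) ^ D.choose 2 := by
    rw [Fintype.prod_prod_type]
    simp only [Finset.prod_const, Finset.card_univ, soloSD_card_pairs, Finset.prod_pow]
  have h2 : ∏ q : {p : Finset (Fin D) // p.card = 2} × {p : Finset (Fin D) // p.card = 2},
      g q.2 = (∏ p, g p) ^ D.choose 2 := by
    rw [Fintype.prod_prod_type]
    simp only [Finset.prod_const, Finset.card_univ, soloSD_card_pairs]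
  rw [h1, h2]; ring

end ThetaBounds

section Main

variable {D : ℕ}

/-- **AE analytic core (multiplicative form).** -/
theorem soloAE_one_le_pow_mul_mahlerMeasure_pow (F : Polynomial ℤ) (hF : F ≠ 0)
    (hD : F.natDegree = D) (ρ : Fin D → ℂ)
    (hρ : univ.val.map ρ = (F.map (Int.castRingHom ℂ)).roots)
    (θ : Finset (Fin D) → ℂ) (hθ : ∀ p, θ p = (∑ i ∈ p, ρ i) ^ 2 - 4 * ∏ i ∈ p, ρ i)
    {ε : ℝ} (hε : 0 ≤ ε)
    (T : Finset ({p : Finset (Fin D) // p.card = 2} × {p : Finset (Fin D) // p.card = 2}))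
    (hT : ∀ q ∈ T, θ q.1.1 ≠ θ q.2.1 ∧ ‖θ q.1.1 - θ q.2.1‖ ≤ ε) :
    1 ≤ ε ^ #T * 2 ^ (5 * (D.choose 2) ^ 2) *
      (F.map (Int.castRingHom ℂ)).mahlerMeasure ^ (2 * D * (D - 1) ^ 2) := by
  classical
  -- abbreviations (kept opaque): g p = max 1 ‖θ p‖ on 2-subsets, J = pairs with distinct values
  obtain ⟨g, hg⟩ : ∃ g : {p : Finset (Fin D) // p.card = 2} → ℝ, ∀ p, g p = max 1 ‖θ p.1‖ :=
    ⟨_, fun _ => rfl⟩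
  obtain ⟨J, hJ⟩ :
      ∃ J : Finset ({p : Finset (Fin D) // p.card = 2} × {p : Finset (Fin D) // p.card = 2}),
      J = univ.filter (fun q => θ q.1.1 ≠ θ q.2.1) := ⟨_, rfl⟩
  have h1g : ∀ p, 1 ≤ g p := fun p => by rw [hg]; exact le_max_left _ _
  have hB1 : ∀ q : {p : Finset (Fin D) // p.card = 2} × {p : Finset (Fin D) // p.card = 2},
      1 ≤ 2 * g q.1 * g q.2 := fun q => soloAE_one_le_two_mul_max _ _ (h1g _) (h1g _)
  have hTJ : T ⊆ J := fun q hq => by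
    rw [hJ]; exact Finset.mem_filter.mpr ⟨Finset.mem_univ _, (hT q hq).1⟩
  -- (i): the integrality lower bound
  have hAE1 := soloSD_one_le_abs_pow_mul_prod_norm_sub F hF hD ρ hρ θ hθ
  rw [← hJ] at hAE1
  -- (ii): the trivial upper bound for the product over `J`
  have hstep : ∏ q ∈ J, ‖θ q.1.1 - θ q.2.1‖ ≤ ε ^ #T *
      ∏ q : {p : Finset (Fin D) // p.card = 2} × {p : Finset (Fin D) // p.card = 2},
        (2 * g q.1 * g q.2) := by
    calc ∏ q ∈ J, ‖θ q.1.1 - θ q.2.1‖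
        ≤ ∏ q ∈ J, (if q ∈ T then ε else 2 * g q.1 * g q.2) := by
          refine Finset.prod_le_prod (fun q _ => norm_nonneg _) (fun q _ => ?_)
          split_ifs with h
          · exact (hT q h).2
          · rw [hg, hg]; exact soloAE_norm_sub_le_two_mul_max _ _
      _ = (∏ q ∈ T, (if q ∈ T then ε else 2 * g q.1 * g q.2)) *
            ∏ q ∈ J \ T, (if q ∈ T then ε else 2 * g q.1 * g q.2) := by
          rw [← Finset.prod_sdiff hTJ, mul_comm]
      _ = ε ^ #T * ∏ q ∈ J \ T, (2 * g q.1 * g q.2) := by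
          congr 1
          · rw [Finset.prod_congr rfl (fun q hq => if_pos hq), Finset.prod_const]
          · exact Finset.prod_congr rfl (fun q hq => if_neg (Finset.mem_sdiff.mp hq).2)
      _ ≤ ε ^ #T * ∏ q : {p : Finset (Fin D) // p.card = 2} × {p : Finset (Fin D) // p.card = 2},
            (2 * g q.1 * g q.2) :=
          mul_le_mul_of_nonneg_left (Finset.prod_le_prod_of_subset_of_one_le
            (Finset.subset_univ _) (fun q _ => zero_le_one.trans (hB1 q))
            (fun q _ _ => hB1 q)) (pow_nonneg hε _)
  -- the factors of the upper bound
  have hG0 : 0 ≤ ∏ p, g p := Finset.prod_nonneg fun p _ => zero_le_one.trans (h1g p)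
  have hG : ∏ p, g p ≤ 4 ^ D.choose 2 * (∏ l, max 1 ‖ρ l‖) ^ (2 * (D - 1)) := by
    have := soloAE_prod_max_one_norm_theta_le ρ θ hθ
    simpa only [hg] using this
  have h4 : (4 : ℝ) ^ D.choose 2 = 2 ^ (2 * D.choose 2) := by rw [pow_mul]; norm_num
  rw [h4] at hG
  have hpairs := soloAE_prod_pairs_eq (D := D) g
  have hM := soloAE_mahlerMeasure_map_eq F ρ hρ
  have hexp := soloAE_four_mul_choose_two_mul D
  -- assemble
  rw [hM, ← hexp]
  rw [← hexp] at hAE1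
  calc (1 : ℝ) ≤ |(F.leadingCoeff : ℝ)| ^ (4 * D.choose 2 * (D - 1)) *
        ∏ q ∈ J, ‖θ q.1.1 - θ q.2.1‖ := hAE1
    _ ≤ |(F.leadingCoeff : ℝ)| ^ (4 * D.choose 2 * (D - 1)) *
        (ε ^ #T * (2 ^ (D.choose 2) ^ 2 *
          (2 ^ (2 * D.choose 2) * (∏ l, max 1 ‖ρ l‖) ^ (2 * (D - 1))) ^ (2 * D.choose 2))) := by
        refine mul_le_mul_of_nonneg_left (hstep.trans ?_) (pow_nonneg (abs_nonneg _) _)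
        rw [hpairs]
        exact mul_le_mul_of_nonneg_left (mul_le_mul_of_nonneg_left
          (pow_le_pow_left₀ hG0 hG _) (by positivity)) (pow_nonneg hε _)
    _ = ε ^ #T * 2 ^ (5 * (D.choose 2) ^ 2) *
        (|(F.leadingCoeff : ℝ)| * ∏ l, max 1 ‖ρ l‖) ^ (4 * D.choose 2 * (D - 1)) := by
        ring

/-- **AE analytic core (logarithmic form).** -/
theorem soloAE_card_mul_log_le (F : Polynomial ℤ) (hF : F ≠ 0)
    (hD : F.natDegree = D) (ρ : Fin D → ℂ)
    (hρ : univ.val.map ρ = (F.map (Int.castRingHom ℂ)).roots)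
    (θ : Finset (Fin D) → ℂ) (hθ : ∀ p, θ p = (∑ i ∈ p, ρ i) ^ 2 - 4 * ∏ i ∈ p, ρ i)
    {ε : ℝ} (hε : 0 < ε)
    (T : Finset ({p : Finset (Fin D) // p.card = 2} × {p : Finset (Fin D) // p.card = 2}))
    (hT : ∀ q ∈ T, θ q.1.1 ≠ θ q.2.1 ∧ ‖θ q.1.1 - θ q.2.1‖ ≤ ε) :
    (#T : ℝ) * Real.log (1 / ε) ≤
      ((2 * D * (D - 1) ^ 2 : ℕ) : ℝ) * Real.log (F.map (Int.castRingHom ℂ)).mahlerMeasure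
        + ((5 * (D.choose 2) ^ 2 : ℕ) : ℝ) * Real.log 2 := by
  have h := soloAE_one_le_pow_mul_mahlerMeasure_pow F hF hD ρ hρ θ hθ hε.le T hT
  have hF' : F.map (Int.castRingHom ℂ) ≠ 0 :=
    (Polynomial.map_ne_zero_iff (Int.castRingHom ℂ).injective_int).mpr hF
  have hMpos : 0 < (F.map (Int.castRingHom ℂ)).mahlerMeasure :=
    Polynomial.mahlerMeasure_pos_of_ne_zero hF'
  have hlog := Real.log_le_log one_pos h
  rw [Real.log_one, Real.log_mul (by positivity) (by positivity),
    Real.log_mul (by positivity) (by positivity), Real.log_pow, Real.log_pow,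
    Real.log_pow] at hlog
  rw [one_div, Real.log_inv]
  linarith

end Main

end Summit.Schanuel.Schanuel.Theorems
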